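import Summits.BirchSwinnertonDyer.BirchSwinnertonDyer.Theorems.QuadraticBranchSignedControlPlusEtaLowerInclusionKuriharaCutManinFree
import Summits.BirchSwinnertonDyer.BirchSwinnertonDyer.Theorems.QuadraticBranchSignedControlPlusEtaLowerInclusionR0OfLowerBSDByName
import HarnessLib

/-!
# Route `QuadraticBranchSignedControl` (rung K8, cell `bsd-potss`), crux `PlusEtaLowerInclusion`
# (item stmt-BirchSwinnertonDyer-19601): THE TAMAGAWA STUB OF THE KURIHARA CUT SPLIT BY ANALYTIC RANK —
# its `L(W,1) ≠ 0` rows are ALREADY under the registered L₀ stub `stub_etaLower_r0_lowerBSD` (converse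
# control, p468146); what is left is (E⁺_η) on the Tamagawa rows with `L(W,1) = 0`
# (a `--supports` file; seat `bsd-potss-k8eta-c1`, gen 9)

HONEST FRAMING (cell `bsd-potss`, run/shared/lean/pub/bsd-potss/; FULL-BSD rank ≤ 1 programme,
tranche 1b, HUMAN RULING D-0036/D-0074; verbatim in every file): the target of record is FULL BSD for
every analytic-rank ≤ 1 curve over `ℚ`; this cell attacks rows B4/B5/B8 (additive potentially
supersingular primes). Crux 19601 `PlusEtaLowerInclusion` — Kobayashi's Eisenstein (lower) inclusion
of the even main conjecture at `η = ω^{(p−1)/2}` for every good supersingular `a_p(V) = 0` twist `V/ℚ`,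
`p ≥ 5`, whose `p`-adic tower is onto = Kato's lower IMC inclusion for the ADDITIVE partner
`W = V ⊗ χ_{p*}` — is OPEN class-wide and in print for no non-CM `V`. THIS FILE closes nothing, books
nothing and claims `BSD(W, p)` for no pair.

WHAT. Skeleton v5 (planner g26) registers, next to the Σ₁ Kurihara stub and the four v4 stubs, the
hardest stub `stub_etaLower_tamagawaRows` = (K3): (E⁺_η) on every tower-onto Gss2 pair whose partner `W`
has `p ∣ ∏ c_ℓ(W)` (Kim Remark 6.2: no unit Kurihara number there; per row = Λ-primitivity of
`κ^{Kato,∞}(W)`, no finite certificate in print). v4's registered stub `stub_etaLower_r0_lowerBSD` (L₀: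
`MissingLowerBoundAt W p` — `ord_p #Ш(W)_an ≤ ord_p #Ш(W)` — on the tower-onto partners with
`L(W,1) ≠ 0`) together with ctrl g4's LANDED converse control
`PlusEtaLowerInclusionR0OfLowerBSD.stub_etaLower_r0_ofLowerBSD` (p468146: Poitou–Tate + Kobayashi 2.2_η /
4.1_η + Kitajima–Otsuki 1.3 + modularity + GZK ⟹ L₀ → (E⁺_η) on those pairs) ALREADY covers the
Tamagawa rows of analytic rank zero. This file records the resulting split, BY NAME on the binders:

* §7 `tamagawaRows_of_r0LowerBSD_of_posRankRows`: the body of `Sig.stub_etaLower_tamagawaRows`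
  (verbatim) follows from the six named facts of the converse road + the body of
  `Sig.stub_etaLower_r0_lowerBSD` (verbatim, hypothesis `hlow`) + (K3⁺) «(E⁺_η) on the tower-onto pairs
  with `p ∣ ∏ c_ℓ(W)` AND `L(W,1) = 0`» (hypothesis `hTamPos`).
* §8 `plusEtaLowerInclusion_of_kim111_of_maninFacts_of_kuriharaUnit_of_r0LowerBSD_of_posRankTamagawaRows`:
  the route decl BY NAME from (K1) Kim 1.11_η, (M) the four Manin-constant facts, (K2b) Kurihara's
  conjecture mod `p` on the Tamagawa-free partners, the six converse-control facts, L₀ (`hlow`) and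
  (K3⁺) — one line over `…KuriharaCutManinFree` §5 and §7.
* §9 `maninInput_of_quadraticBranch_of_irreducible`: §4 of the companion with `ρ̄_{W,p}` onto weakened to
  `W[p]` irreducible (all that its proof used) — the Manin/period binders are theorems on the
  non-surjective irreducible rows too (sibling crux `PlusEtaMainConjectureNonsurj`, item 19606).

READING FOR THE PLANNER (numbers = the seat's census of the 40 tower-onto rows): under this split the
(K3)-locus (20 rows: r0 5 + r1 15) divides into its `L(W,1) ≠ 0` part (5 rows — all 5 certified at level
zero: 4 by unit `Ш_an`, `288600bn1` by a level-2 Kurihara number, records `…PlusEtaR0Rows0x` /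
`…R0KuriharaRecords06`), which is L₀'s business (Kato's lower inclusion AT LEVEL ZERO for `r_an = 0`,
certifiable per row by Kim 2026 Thm. 1.8 (6)), and (K3⁺) = the 15 positive-analytic-rank Tamagawa rows
(14 certified by the Tamagawa / Mordell–Weil roads, residue `69150v1` — the one row whose certificate
needs an Iwasawa-level input, the `η`-adic height unit / `λ(X_η) ≥ 3`). So the genuinely un-instrumented
content of the cut is (K3⁺) at the rows with a height defect. OPTIONAL RESHAPE: replace
`stub_etaLower_tamagawaRows` by `stub_etaLower_tamagawaRows_posRank` (= `hTamPos` below); the r0 Tamagawa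
rows then ride `stub_etaLower_r0_lowerBSD`, which is registered anyway. No urgency; v5 stays correct.

HONEST LABEL: CONDITIONAL closers (displayed hypotheses; (K1), (M), the six converse-control inputs are
named Literature facts); L₀, (K2b), (K3⁺) are OPEN class-wide; nothing is booked; no census row moves;
BSD is not proved by any of this.

References: [Kim2022StructureSelmer] Thm. 1.8 (6), Thm. 1.11, Conj. 1.9, Remark 6.2; [Kobayashi2003]
§4 (p. 8), Thm. 2.2, Thm. 4.1; [KitajimaOtsuki2018] Thm. 1.3; [Kato2004Asterisque] Conj. 12.10;
[MilneADT2006] Ch. I Thm. 4.10 (Poitou–Tate).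
-/

set_option autoImplicit false
-- sibling precedent (`…PlusEtaLowerInclusionKuriharaCut.lean`): the directory name repeats the summit name
set_option linter.dupNamespace false

noncomputable section

open scoped Classical MatrixGroups ModularForm

namespace Summit.BirchSwinnertonDyer.BirchSwinnertonDyer.Theorems.PlusEtaManinInput

open CongruenceSubgroup WeierstrassCurve
  Literature.NumberTheory.EllipticCurves
  Literature.NumberTheory.EllipticCurves.ModularForms
  Literature.NumberTheory.Automorphic
  Literature.NumberTheory.GaloisCohomology
  Literature.NumberTheory.EllipticCurves.Rank1Residual
  Literature.NumberTheory.EllipticCurves.Rank1Residual.Typed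
  Summit.BirchSwinnertonDyer.Rank1Residual
  Summit.BirchSwinnertonDyer.BirchSwinnertonDyer.Theorems
  Summit.BirchSwinnertonDyer.BirchSwinnertonDyer.Theses.QuadraticBranchSignedControl

open Summit.BirchSwinnertonDyer.Rank1Residual.Additive hiding EtaSignedSelmerDualData
  IsQuadraticBranchPlusLFunction IsQuadraticBranchMinusLFunction

/-! ## §7 The Tamagawa stub split by analytic rank -/

/-- **(K3) ⟸ six converse-control facts + L₀ + (K3⁺).** The body of the registered stub
`stub_etaLower_tamagawaRows` — (E⁺_η) on every tower-onto Gss2 pair whose globally minimal partner `W`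
has `p ∣ ∏ c_ℓ(W)` — follows from: Poitou–Tate duality for Selmer structures (`hPT`), Kobayashi 2003
Thm. 2.2 / 4.1 at `η` (`h22`, `h41`), Kitajima–Otsuki 2018 Thm. 1.3 (`hKO`), modularity (`hmod`), GZK
(`hGZK`); the body of the registered L₀ stub `stub_etaLower_r0_lowerBSD` (`hlow`: `MissingLowerBoundAt W p`
on the tower-onto partners with `L(W,1) ≠ 0`); and (K3⁺) `hTamPos`: (E⁺_η) on the pairs with
`p ∣ ∏ c_ℓ(W)` and `L(W,1) = 0`. Split on `L(W,1) = 0`; the non-vanishing branch is ctrl g4's landed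
converse road `PlusEtaLowerInclusionR0OfLowerBSD.stub_etaLower_r0_ofLowerBSD` (p468146). CONDITIONAL;
closes nothing by itself. [cite: Kobayashi2003, Thm. 2.2, Thm. 4.1, §4 (p. 8)] [cite: KitajimaOtsuki2018, Thm. 1.3]
[cite: MilneADT2006, Ch. I, Thm. 4.10] [cite: Kim2022StructureSelmer, Thm. 1.8 (6), Remark 6.2] -/
theorem tamagawaRows_of_r0LowerBSD_of_posRankRows
    (hPT : poitouTate_selmerStructure_duality_real ℚ)
    (h22 : Kobayashi2003.thm22_etaSignedSelmerDual_finite_torsion)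
    (h41 : Kobayashi2003.thm41_plusEtaCharIdeal_dvd)
    (hKO : KitajimaOtsuki2018.mainThm13_etaSignedSelmerDual_noFiniteSubmodule)
    (hmod : hasEntireLFunction_rat) (hGZK : rank_eq_analyticRank_of_analyticRank_le_one)
    (hlow : ∀ (V : WeierstrassCurve ℚ) [V.IsElliptic] [V.IsGloballyMinimal] (W : WeierstrassCurve ℚ)
      [W.IsElliptic] [W.IsGloballyMinimal] (C : VariableChange ℚ) (p : ℕ) [Fact p.Prime],
      5 ≤ p → C • W.quadraticTwist ((-1) ^ (p / 2) * p) = V →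
      V.HasGoodReductionAtPrime p → V.frobeniusTrace p = 0 →
      (∀ m : ℕ, V.HasSurjectiveModNGaloisRep (p ^ m : ℕ)) → W.entireLFunction 1 ≠ 0 →
        MissingLowerBoundAt W p)
    (hTamPos : ∀ (V : WeierstrassCurve ℚ) [V.IsElliptic] [V.IsGloballyMinimal] (W : WeierstrassCurve ℚ)
      [W.IsElliptic] [W.IsGloballyMinimal] (C : VariableChange ℚ) (p : ℕ) [Fact p.Prime],
      5 ≤ p → C • W.quadraticTwist ((-1) ^ (p / 2) * p) = V → V.HasGoodReductionAtPrime p →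
      V.frobeniusTrace p = 0 → (∀ m : ℕ, V.HasSurjectiveModNGaloisRep (p ^ m : ℕ)) →
      p ∣ W.tamagawaProduct → W.entireLFunction 1 = 0 → QuadraticBranchPlusEtaLowerInclusionAt V p) :
    ∀ (V : WeierstrassCurve ℚ) [V.IsElliptic] [V.IsGloballyMinimal] (W : WeierstrassCurve ℚ)
      [W.IsElliptic] [W.IsGloballyMinimal] (C : VariableChange ℚ) (p : ℕ) [Fact p.Prime],
      5 ≤ p → C • W.quadraticTwist ((-1) ^ (p / 2) * p) = V → V.HasGoodReductionAtPrime p →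
      V.frobeniusTrace p = 0 → (∀ m : ℕ, V.HasSurjectiveModNGaloisRep (p ^ m : ℕ)) →
      p ∣ W.tamagawaProduct → QuadraticBranchPlusEtaLowerInclusionAt V p := by
  intro V _ _ W _ _ C p _ h5 hCV hg ha hs htam
  by_cases hL : W.entireLFunction 1 = 0
  · exact hTamPos V W C p h5 hCV hg ha hs htam hL
  · exact PlusEtaLowerInclusionR0OfLowerBSD.stub_etaLower_r0_ofLowerBSD hPT h22 h41 hKO hmod hGZK V W C p
      h5 hCV hg ha hs hL (hlow V W C p h5 hCV hg ha hs hL)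

/-! ## §8 The cut with the Manin input discharged and the Tamagawa rows split by analytic rank -/

/-- **THE KURIHARA CUT, MANIN-FREE, TAMAGAWA ROWS SPLIT BY ANALYTIC RANK.** `PlusEtaLowerInclusion`
follows from (K1) Kim 2026 Thm. 1.11 (1) ⟹ (3) at `η` (`hKim`); (M) the Manin-constant facts `hM`,
`hAU`, `hC2`, `hnf`; (K2b) Kurihara's conjecture mod `p` for every datum of every Tamagawa-`p`-free
tower-onto partner (`hKur`); the six converse-control facts `hPT h22 h41 hKO hmod hGZK`; L₀ on the
tower-onto partners with `L(W,1) ≠ 0` (`hlow`, the body of the registered `stub_etaLower_r0_lowerBSD`);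
and (K3⁺) (E⁺_η) on the Tamagawa rows with `L(W,1) = 0` (`hTamPos`). One line over
`plusEtaLowerInclusion_of_kim111_of_maninFacts_of_kuriharaUnit_of_tamagawaRows` (p609071 §5) and §7.
CONDITIONAL (displayed hypotheses); closes nothing by itself; nothing booked.
[cite: Kim2022StructureSelmer, Thm. 1.11 (PDF p. 8), Conj. 1.9, Thm. 1.8 (6)]
[cite: Kobayashi2003, §4 Even main conjecture (p. 8), Thm. 2.2, Thm. 4.1] [cite: Stevens1989, Lemmas (5.2), (5.4)] -/
theorem plusEtaLowerInclusion_of_kim111_of_maninFacts_of_kuriharaUnit_of_r0LowerBSD_of_posRankTamagawaRows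
    (hKim : Kim2026.thm111_etaEisensteinInclusion_of_kuriharaNumber_ne_zero)
    (hM : mazur_not_dvd_maninConstant_of_odd)
    (hAU : abbesUllmo_not_dvd_maninConstant_of_not_dvd_level)
    (hC2 : cesnavicius_not_two_dvd_maninConstant_of_two_dvd_level)
    (hnf : exists_isNewformOf)
    (hKur : ∀ (V : WeierstrassCurve ℚ) [V.IsElliptic] [V.IsGloballyMinimal] (W : WeierstrassCurve ℚ)
      [W.IsElliptic] [W.IsGloballyMinimal] (C : VariableChange ℚ) (p : ℕ) [Fact p.Prime],
      5 ≤ p → C • W.quadraticTwist ((-1) ^ (p / 2) * p) = V → V.HasGoodReductionAtPrime p →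
      V.frobeniusTrace p = 0 → (∀ m : ℕ, V.HasSurjectiveModNGaloisRep (p ^ m : ℕ)) →
      ¬ p ∣ W.tamagawaProduct →
      ∀ {NW : ℕ} [NeZero NW] (D : ModularParametrizationData W NW),
        ∃ (n : ℕ) (_ : NeZero n), Kato.IsKolyvaginProduct W p 1 n ∧
          (∀ (ℓ : ℕ) [Fact ℓ.Prime], ℓ ∣ n →
            Nat.card {P : ((WeierstrassCurve.integralModelInt W).map
              (Int.castRingHom (ZMod ℓ))).toAffine.Point // p • P = 0} ≤ p) ∧
          ∃ ψ : (ℓ : ℕ) → (ZMod ℓ)ˣ →* Multiplicative (ZMod p),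
            (∀ ℓ ∈ n.primeFactors, Function.Surjective (ψ ℓ)) ∧ kuriharaNumber D.f p n ψ ≠ 0)
    (hPT : poitouTate_selmerStructure_duality_real ℚ)
    (h22 : Kobayashi2003.thm22_etaSignedSelmerDual_finite_torsion)
    (h41 : Kobayashi2003.thm41_plusEtaCharIdeal_dvd)
    (hKO : KitajimaOtsuki2018.mainThm13_etaSignedSelmerDual_noFiniteSubmodule)
    (hmod : hasEntireLFunction_rat) (hGZK : rank_eq_analyticRank_of_analyticRank_le_one)
    (hlow : ∀ (V : WeierstrassCurve ℚ) [V.IsElliptic] [V.IsGloballyMinimal] (W : WeierstrassCurve ℚ)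
      [W.IsElliptic] [W.IsGloballyMinimal] (C : VariableChange ℚ) (p : ℕ) [Fact p.Prime],
      5 ≤ p → C • W.quadraticTwist ((-1) ^ (p / 2) * p) = V →
      V.HasGoodReductionAtPrime p → V.frobeniusTrace p = 0 →
      (∀ m : ℕ, V.HasSurjectiveModNGaloisRep (p ^ m : ℕ)) → W.entireLFunction 1 ≠ 0 →
        MissingLowerBoundAt W p)
    (hTamPos : ∀ (V : WeierstrassCurve ℚ) [V.IsElliptic] [V.IsGloballyMinimal] (W : WeierstrassCurve ℚ)
      [W.IsElliptic] [W.IsGloballyMinimal] (C : VariableChange ℚ) (p : ℕ) [Fact p.Prime],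
      5 ≤ p → C • W.quadraticTwist ((-1) ^ (p / 2) * p) = V → V.HasGoodReductionAtPrime p →
      V.frobeniusTrace p = 0 → (∀ m : ℕ, V.HasSurjectiveModNGaloisRep (p ^ m : ℕ)) →
      p ∣ W.tamagawaProduct → W.entireLFunction 1 = 0 → QuadraticBranchPlusEtaLowerInclusionAt V p) :
    PlusEtaLowerInclusion :=
  plusEtaLowerInclusion_of_kim111_of_maninFacts_of_kuriharaUnit_of_tamagawaRows hKim hM hAU hC2 hnf hKur
    (tamagawaRows_of_r0LowerBSD_of_posRankRows hPT h22 h41 hKO hmod hGZK hlow hTamPos)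

/-! ## §9 The Manin input under `E[p]` IRREDUCIBLE only (serves the small-image sibling crux 19606 too) -/

/-- **The Manin input needs only `W[p]` irreducible, not `ρ̄_{W,p}` onto.** Same statement and proof as
`maninInput_of_quadraticBranch` (p609071 §4) with the hypothesis weakened to
`W.HasIrreducibleModPGaloisRep p` — the only use of surjectivity there was irreducibility (for an isogeny
of degree prime to `p` to the optimal curve, `SkinnerUrban2014.exists_isogeny_not_dvd_degree_of_irreducible`,
and for Greenberg–Vatsal's period remark). So the Manin/period binders of the Kurihara-type roads are
theorems on the NON-surjective irreducible rows as well (the sibling crux `PlusEtaMainConjectureNonsurj`,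
item 19606, whose rows have `p`-inert Cartan image, `p ≥ 5`). Modulo `hM hAU hC2 hnf`.
[cite: Stevens1989, Lemmas (5.2), (5.4)] [cite: GreenbergVatsal2000, §3, Remark 3.4]
[cite: Mazur1978, Cor. 4.1] [cite: Cesnavicius2018, Thm. 1.2] -/
theorem maninInput_of_quadraticBranch_of_irreducible
    (hM : mazur_not_dvd_maninConstant_of_odd)
    (hAU : abbesUllmo_not_dvd_maninConstant_of_not_dvd_level)
    (hC2 : cesnavicius_not_two_dvd_maninConstant_of_two_dvd_level)
    (hnf : exists_isNewformOf)
    {V : WeierstrassCurve ℚ} [V.IsElliptic] [V.IsGloballyMinimal]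
    {W : WeierstrassCurve ℚ} [W.IsElliptic] [W.IsGloballyMinimal]
    (C : VariableChange ℚ) (p : ℕ) [hp : Fact p.Prime] (hp2 : p ≠ 2)
    (hCV : C • W.quadraticTwist ((-1) ^ (p / 2) * p) = V) (hgood : V.HasGoodReductionAtPrime p)
    (hirr : W.HasIrreducibleModPGaloisRep p) :
    ∃ (NW : ℕ) (_ : NeZero NW) (D : ModularParametrizationData W NW),
      ¬ (p : ℤ) ∣ D.maninConstant ∧
      ∃ u : ℚ, ‖(u : ℚ_[p])‖ = 1 ∧ W.realPeriodRat = u * plusPeriod D.f := by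
  haveI : NeZero (W.conductorNorm ℤ) := ⟨(WeierstrassCurve.conductorNorm_pos_holds W).ne'⟩
  obtain ⟨f, hf⟩ := hnf W
  obtain ⟨W₀, _, _, D₀, hf₀, hiso, hmin⟩ :=
    exists_optimal_modularParametrizationData_of_isNewformOf' (W.conductorNorm ℤ) W rfl hf
  have hopt₀ : ∀ z ∈ D₀.L.lattice, ∃ w ∈ periodLattice D₀.f, z = D₀.c * w :=
    D₀.latticeEq_of_forall_modularDegree_le (fun W₂ _ D₂ h₂ ↦ hmin W₂ D₂ (h₂.trans hf₀))
  have hc₀ : ¬ (p : ℤ) ∣ D₀.maninConstant :=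
    not_dvd_maninConstant_of_quadraticBranch_of_isogenous_latticeOptimal hM hAU hC2 hnf C p hp2 hCV
      hgood hiso D₀ hopt₀
  obtain ⟨D, hDf, hDc⟩ :=
    exists_modularParametrizationData_not_dvd_of_isogenous hf p hirr hiso D₀ hf₀ hc₀
  have hper : ∃ u : ℚ, ‖(u : ℚ_[p])‖ = 1 ∧ W.realPeriodRat = u * plusPeriod f := by
    refine SkinnerUrban2014.exists_unit_mul_plusPeriod_of_irreducible_anyPrime W p hirr f hf ?_
    intro W₀' _ _ D₀' hf₀' hopt₀'
    have hle : ∀ z ∈ D₀'.L.lattice, ((D.c : ℚ) : ℂ) * z ∈ D.L.lattice := by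
      intro z hz
      obtain ⟨w, hw, rfl⟩ := hopt₀' z hz
      have hw' : w ∈ periodLattice D.f := by rw [hDf, ← hf₀']; exact hw
      have h1 : (D.c : ℂ) * w ∈ D.L.lattice := D.smul_periodLattice_le w hw'
      have e : ((D.c : ℚ) : ℂ) * ((D₀'.c : ℂ) * w) = (D₀'.c : ℤ) • ((D.c : ℂ) * w) := by
        rw [zsmul_eq_mul]; push_cast; ring
      rw [e]
      exact zsmul_mem h1 _
    have hDc0 : (D.c : ℚ) ≠ 0 := by
      have : D.c ≠ 0 := fun h ↦ hDc (by change (p : ℤ) ∣ D.c; rw [h]; exact dvd_zero _)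
      exact_mod_cast this
    have hiso' : IsIsogenous W W₀' :=
      (isIsogenous_of_forall_mul_mem_lattice D₀'.isNeronLattice.1 D₀'.isNeronLattice.2
        D.isNeronLattice.1 D.isNeronLattice.2 hDc0 hle).symm_of_isElliptic
    exact not_dvd_maninConstant_of_quadraticBranch_of_isogenous_latticeOptimal hM hAU hC2 hnf C p hp2
      hCV hgood hiso' D₀' hopt₀'
  refine ⟨W.conductorNorm ℤ, inferInstance, D, hDc, ?_⟩
  rw [hDf]
  exact hper

end Summit.BirchSwinnertonDyer.BirchSwinnertonDyer.Theorems.PlusEtaManinInput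

end
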